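import Summits.ABC.ABC.Theses.IsogenyGlueCongruence
import Literature.NumberTheory.EllipticCurves.BSDSelmerSkinnerProofs
import Literature.NumberTheory.EllipticCurves.ComplexMultiplicationHasCMIffHoldsProofs
import Literature.NumberTheory.EllipticCurves.ModularityVersionApProofs
import Literature.NumberTheory.EllipticCurves.RootNumberProofs
import HarnessLib

/-!
# Crux `EllipticGluingPrimeBound`, line SketchIdeator5 — stub `stub_notHasCMOfSemistable`
# (a semistable elliptic curve over `ℚ` of conductor `≠ 1` has no complex multiplication)

Stub `stub_notHasCMOfSemistable` of line `SketchIdeator5` of crux U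
`Summit.ABC.ABC.Theses.IsogenyGlueCongruence.EllipticGluingPrimeBound` (stmt-ABC-13919).  The
route consumes U only at SEMISTABLE curves `W` (restriction `U_ss`), and the semistable class has
no CM flank: this file proves that fact.

**Statement.** For every elliptic `W / ℚ` that is semistable over `ℤ` (`W.IsSemistable ℤ`: good
or multiplicative reduction at every finite place of `ℤ`) with `W.conductorNorm ℤ ≠ 1`:
`¬ W.HasCM`.

**Proof** (composition by name of PROVED tree theorems).  `N ≠ 1` gives a prime `p ∣ N`
(`Nat.exists_prime_and_dvd`); `p ∣ N ↔ ¬ W.HasGoodReductionAtPrime p`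
(`WeierstrassCurve.dvd_conductorNorm_iff_not_hasGoodReductionAtPrime`, Diamond–Shurman §8.3 with
Tate's algorithm, `ModularityVersionApProofs`).  At the place `v = primesEquiv.symm p` of `ℤ`,
semistability gives good or multiplicative reduction; good reduction at `v` is good reduction at
`p` (`WeierstrassCurve.hasGoodReductionAtPrime_iff_hasGoodReductionAt_holds`, `RootNumberProofs`),
excluded; so `W` has multiplicative reduction at `v`, i.e. at `p`
(`WeierstrassCurve.hasMultiplicativeReductionAtPrime_iff_hasMultiplicativeReductionAt_holds`), and
a curve over `ℚ` with a multiplicative prime has no CM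
(`Literature.NumberTheory.EllipticCurves.not_hasCM_of_hasMultiplicativeReductionAtPrime` with the
proved classification half `Literature.NumberTheory.EllipticCurves.j_mem_cmJInvariants_of_hasCM_holds`:
`‖j‖_p > 1` at a multiplicative prime versus the thirteen integral CM `j`-invariants).
Everything is proved (axioms `propext`, `Classical.choice`, `Quot.sound`); no `def`, no named fact,
no `sorry`.  Lands `--supports stmt-ABC-13919`.
-/

noncomputable section

-- `Summit.<Summit>.<Problem>` is the mandated summit-side namespace (CONVENTIONS §2); for the
-- single-conjunct summit `ABC` the two coincide, so the duplicate `ABC.ABC` is deliberate.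
set_option linter.dupNamespace false

namespace Summit.ABC.ABC.Theorems.GluingSlices

open Summit.ABC.ABC.Theses.IsogenyGlueCongruence

/-- **A semistable elliptic curve over `ℚ` of conductor `≠ 1` has no complex multiplication**
(stub `stub_notHasCMOfSemistable` of line `SketchIdeator5`).  A prime `p ∣ N` is a prime of bad
reduction (`WeierstrassCurve.dvd_conductorNorm_iff_not_hasGoodReductionAtPrime`), hence — `W`
being semistable at the place of `ℤ` over `p`, and the prime-indexed and place-indexed reduction
predicates agreeing (`…hasGoodReductionAtPrime_iff_hasGoodReductionAt_holds`,
`…hasMultiplicativeReductionAtPrime_iff_hasMultiplicativeReductionAt_holds`) — a prime of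
multiplicative reduction, which excludes CM
(`Literature.NumberTheory.EllipticCurves.not_hasCM_of_hasMultiplicativeReductionAtPrime`,
`Literature.NumberTheory.EllipticCurves.j_mem_cmJInvariants_of_hasCM_holds`). [folklore] -/
theorem stub_notHasCMOfSemistable :
    ∀ (W : WeierstrassCurve ℚ) [W.IsElliptic], W.IsSemistable ℤ → W.conductorNorm ℤ ≠ 1 →
      ¬ W.HasCM := by
  intro W _ hss hN
  obtain ⟨p, hp, hpN⟩ := Nat.exists_prime_and_dvd hN
  haveI : Fact p.Prime := ⟨hp⟩
  -- `p ∣ N`: `W` does not have good reduction at `p`.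
  have hbad : ¬ W.HasGoodReductionAtPrime p :=
    (W.dvd_conductorNorm_iff_not_hasGoodReductionAtPrime p).1 hpN
  -- The place of `ℤ` over `p` and the two prime/place comparison theorems at it.
  have hgood_iff := W.hasGoodReductionAtPrime_iff_hasGoodReductionAt_holds ⟨p, hp⟩
  have hmult_iff := W.hasMultiplicativeReductionAtPrime_iff_hasMultiplicativeReductionAt_holds ⟨p, hp⟩
  -- Semistability at that place: good (excluded) or multiplicative reduction.
  rcases hss ((Rat.HeightOneSpectrum.primesEquiv (R := ℤ)).symm ⟨p, hp⟩) with hgood | hmult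
  · exact absurd (hgood_iff.2 hgood) hbad
  · exact Literature.NumberTheory.EllipticCurves.not_hasCM_of_hasMultiplicativeReductionAtPrime
      Literature.NumberTheory.EllipticCurves.j_mem_cmJInvariants_of_hasCM_holds W
      (hmult_iff.2 hmult)

end Summit.ABC.ABC.Theorems.GluingSlices

end
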